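import Summits.HodgeConjecture.HodgeConjecture.Theorems.Ring2AbelianAllAndreMumfordTopClass
import Summits.HodgeConjecture.HodgeConjecture.Theorems.Ring2AbelianAllAndreThreefoldPencils
import HarnessLib

/-!
# Ring 2 · sub-cell AbelianAll (ALL ABELIAN VARIETIES), André axis, part XXXIX-b — SCHOLL'S FORMULA: THE KLEIMAN IDENTITIES OF ALL
# MIDDLE LEFSCHETZ BLOCKS. For every polarised abelian variety `(A, θ)` of dimension `g` and every `i ≤ g`:
# `Σ_j C(g,j) C(g-j,i-2j) · θʲ ∪ [ℓ^{i-2j}]_*((x ∪ θ^{g-i}) ∪ θʲ) = c₀ · x` on `Hⁱ(A(ℂ); ℂ)`, `c₀ ≠ 0`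

HONEST FRAMING (page 1, verbatim): **research route, not a corollary; conditional on HC_CM plus one named
minimal statement.** Cell line: research route conditional on HC_CM; not a corollary; Q11.4-sentence-2
already refuted in dim ≥ 3. Nothing in this file proves a case of the Hodge conjecture; `HC_CM` does not occur in this file.

Gen-31 file of the `ab-andre-2` seat (cell `pub-hodge-ring2`, sub-cell AbelianAll = ALL abelian varieties). With part XXXIX-a this file
DISCHARGES the hypothesis `hF` of part XXXVIII-j (`lefschetzB_pencil_of_groupLaw_of_kleimanIdentities_three`) for EVERY block `b`:
the fibrewise single-`ℓ`-word identity is SCHOLL'S FORMULA [Scholl 1994, (5.9.1)], quoted by [Milne 1999, Rem. 5.11]: "define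
`f_i = Σ_{max(0,i-g) ≤ j ≤ i/2} 1/(j!(g-i+j)!(i-2j)!) p^*([Dʲ]) · q^*([Dʲ]) · [M]^{i-2j}` … `√(-1)^i deg(λ_D) f_i` is the inverse of the strong
Lefschetz isomorphism “cup with `[D]^{g-i}`”", `M = m^*D − p^*D − q^*D` the Mumford (Poincaré) class.

## The proof (new, three lines; the tree's first proof of Scholl's formula, in cohomology)

`m^*θ = pr₁^*θ + ℓ + pr₂^*θ`, so `m^*(θ^g) = Σ_{j+e+n=g} (g; j,e,n) pr₁^*θʲ ∪ ℓ^e ∪ pr₂^*θⁿ` (trinomial theorem, even degrees commute); the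
monomial `pr₁^*θʲ ∪ ℓ^e ∪ pr₂^*θⁿ` has `([N] × 1)^*`-weight `N^{2j+e}`, hence acts as ZERO on `Hⁱ(A)` unless `2j + e = i` (part XXXVII-g₁'s
selection rule), and for `2j + e = i` it acts as the Kleiman word `x ↦ θʲ ∪ [ℓ^{i-2j}]_*((x ∪ θ^{g-i}) ∪ θʲ)` (parts XXXVII-g₀, XXXVIII-c).
By part XXXIX-a, `[m^*θ^g]_* = (-1)^i c` on `Hⁱ` with ONE constant `c`; on `H¹` the sum is `g · [ℓ]_*(x ∪ θ^{g-1}) = g c₁ x`, `c₁ ≠ 0`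
(part XXXVII-f), so `c ≠ 0`. Hence the Kleiman identity of EVERY block, with coefficients `C(g,j) C(g-j,i-2j) = g!/(j!(i-2j)!(g-i+j)!)`
— Scholl's coefficients times `g!`.

## What is proved (sorry-free; no definition, no named fact)

* §1 `cupProduct_cupPow_cupPow` (`θᵃ ∪ θᵇ = θ^{a+b}`), `corrAction_cupProduct_map_snd'` (part XXXVIII-c's projection formula in a free
  degree spelling), `map_mul_ofRatClass_two_eq` (`m^*θ = pr₁^*θ + (ℓ + pr₂^*θ)`).
* §2 `map_nsmul_whiskerRight_monomial` (`([N] × 1)^*(pr₁^*θʲ ∪ ℓ^e ∪ pr₂^*θⁿ) = N^{2j+e} · (…)`), `corrAction_monomial_eq_zero_of_ne`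
  (the monomial acts as zero on `Hᵃ`, `a ≠ 2j + e`), `corrAction_monomial_eq_word` (for `2j + e = i` it acts as the Kleiman word),
  `corrAction_fst_cupPow_add_eq_sum` (binomial expansion of the inner factor under `[·]_*`).
* §3 **`corrAction_pullMul_cupPow_eq_sum`** — `[m^*θ^g]_* x = Σ_{l ≤ i/2} C(g,l) C(g-l,i-2l) · θˡ ∪ [ℓ^{i-2l}]_*((x ∪ θ^{g-i}) ∪ θˡ)` on `Hⁱ`,
  `i + s = g`; **`exists_kleimanCoefficients_block`** — THE KLEIMAN IDENTITY OF THE BLOCK `(b, r)`, `b + r + 1 = k`, `g = k + 1`, for EVERY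
  `b`, in the exact shape `hF` of part XXXVIII-j (exponent pairs `(i_l, j_l) = (b+1-2l, l)`, `l ≤ (b+1)/2`).

## Documentary interface — PRINT / LEAN / GAP

PRINT: [Scholl1994ClassicalMotives, §5 (5.9.1)]; [Milne1999LefschetzClasses, Thm. 5.10 (proof) and Rem. 5.11]; [Kunnemann1993, Thm. 3.1];
[Kleiman1968AlgebraicCycles, App. to §2, 2A9–2A11]; [MumfordAV1970, §1 (2)–(4), §6 Cor. 3]. LEAN: the displayed theorems, fact-free; the
normalisation differs from print (`ℓ = ℓ(θ) ⊗ 1` real, no Tate twist; coefficients scaled by `g!`; `c₀` an unspecified non-zero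
constant). GAP: none — part XXXIX-c assembles `B⋆(𝒳, η)` for compact abelian pencils of every relative dimension.
-/

noncomputable section

set_option linter.dupNamespace false

namespace Summit.HodgeConjecture.HodgeConjecture.Ring2.AbelianAll

open CategoryTheory CategoryTheory.Limits AlgebraicGeometry MonoidalCategory CartesianMonoidalCategory
open Literature.AlgebraicGeometry Literature.AlgebraicGeometry.Motives
open Literature.AlgebraicGeometry.HodgeTheory
open Literature.AlgebraicTopology.SingularHomology (singularCohomology cupProduct cupProduct_map cupProduct_one one_cupProduct
  cupProduct_assoc cupProduct_gradedComm_holds)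
open Literature.AlgebraicTopology.CharacteristicClasses (cupPow cupPow_zero cupPow_succ map_cupPow cupPow_smul)
open Summit.HodgeConjecture.CorCM.Model
open scoped MonObj

/-! ## §1 Generic lemmas -/

section Generic

variable {X : SchemeOver ℂ} {n : ℕ}

/-- **`xᵃ ∪ xᵇ = x^{a+b}`** for a degree-two class, in a free spelling of the exponent `m = a + b`. [cite: HatcherAT2002, §3.2 Prop. 3.10] -/
theorem cupProduct_cupPow_cupPow {Y : Type} [TopologicalSpace Y] (x : singularCohomology ℂ ℂ Y 2) (a : ℕ) :
    ∀ (b m : ℕ) (h : 2 * a + 2 * b = 2 * m), cupProduct h (cupPow ℂ x a) (cupPow ℂ x b) = cupPow ℂ x m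
  | 0, m, h => by
    obtain rfl : m = a := by omega
    rw [cupPow_zero]
    exact cupProduct_one _
  | b + 1, m, h => by
    obtain ⟨m', rfl⟩ : ∃ m', m = m' + 1 := ⟨m - 1, by omega⟩
    rw [cupPow_succ ℂ x b, ← cupProduct_assoc (show 2 * a + 2 * b = 2 * m' by omega) (show 2 * b + 2 = 2 * (b + 1) by omega)
        (show 2 * m' + 2 = 2 * (m' + 1) by omega) h,
      cupProduct_cupPow_cupPow x a b m' (show 2 * a + 2 * b = 2 * m' by omega), cupPow_succ]

/-- **`[cl ∪ pr₂^* q]_* c = [cl]_*(c ∪ q)`** (part XXXVIII-c's `corrAction_cupProduct_map_snd`) with the degree of `γ ∪ pr₂^* q` spelled freely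
as `2f` (`cl ∪ pr₂^* q ∈ H^{2f}`). [cite: VoisinHodgeII2003, proof of Thm. 10.17 (10.7)] [cite: HatcherAT2002, §3.2 Prop. 3.10 and Thm. 3.11] -/
theorem corrAction_cupProduct_map_snd' (μ' : OrientationFamily) (hX : IsSmoothProjective n X) {e k f a a' b' : ℕ}
    (h : 2 * e + 2 * k = 2 * f) (h' : a + 2 * k = a') (hab : a' + 2 * e = b' + 2 * n) (hab' : a + 2 * f = b' + 2 * n)
    (cl : complexBetti (X ⊗ X) (2 * e)) (q : complexBetti X (2 * k)) (c : complexBetti X a) :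
    corrAction μ' hX hX hab' (cupProduct h cl (complexBetti.map (snd X X) (2 * k) q)) c =
      corrAction μ' hX hX hab cl (cupProduct h' c q) := by
  obtain rfl : f = e + k := by omega
  exact corrAction_cupProduct_map_snd μ' hX h h' hab hab' cl q c

end Generic

/-! ## §2 The monomials `pr₁^*θʲ ∪ ℓ^e ∪ pr₂^*θⁿ` of `m^*θ^g`: weights, vanishing, and the Kleiman words -/

section Monomials

variable (A : AbelianVariety ℂ)

/-- `Θ` — the complexification `θ ⊗ 1 ∈ H²(A(ℂ); ℂ)` of a rational degree-two class (display notation). -/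
local notation3 (prettyPrint := false) "Θℂ[" A ", " θ "]" => ofRatClass (ComplexPoints (AbelianVariety.X A)) 2 θ
/-- `ℓ` — the complexified Poincaré (Mumford) class `(m^*θ − pr₁^*θ − pr₂^*θ) ⊗ 1 ∈ H²((A × A)(ℂ); ℂ)` (display notation). -/
local notation3 (prettyPrint := false) "ℓℂ[" A ", " θ "]" => ofRatClass (ComplexPoints (AbelianVariety.X A ⊗ AbelianVariety.X A)) 2
  (BettiUniverse.pull μ[AbelianVariety.X A] 2 θ - BettiUniverse.pull (fst (AbelianVariety.X A) (AbelianVariety.X A)) 2 θ -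
    BettiUniverse.pull (snd (AbelianVariety.X A) (AbelianVariety.X A)) 2 θ)

/-- **`m^*θ = pr₁^*θ + (ℓ + pr₂^*θ)`** in `H²((A × A)(ℂ); ℂ)` — the definition of the Poincaré class, rearranged. [cite: MumfordAV1970, §6 Cor. 3] -/
theorem map_mul_ofRatClass_two_eq (θ : bettiCohomology A.X 2) :
    complexBetti.map μ[A.X] 2 Θℂ[A, θ] =
      complexBetti.map (fst A.X A.X) 2 Θℂ[A, θ] + (ℓℂ[A, θ] + complexBetti.map (snd A.X A.X) 2 Θℂ[A, θ]) := by
  rw [map_sub, map_sub, ofRatClass_pull, ofRatClass_pull, ofRatClass_pull]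
  abel

/-- **`([N] × 1)^*(pr₁^*θʲ ∪ (ℓ^e ∪ pr₂^*θⁿ)) = N^{2j+e} · (pr₁^*θʲ ∪ (ℓ^e ∪ pr₂^*θⁿ))`**: `[N]^*θ = N²θ`, `([N] × 1)^*ℓ = Nℓ`
(part XXXVII-h), `([N] × 1)^* pr₂^* = pr₂^*`. [cite: MumfordAV1970, §6 Cor. 3 and §1 (4)] [cite: HatcherAT2002, §3.2 Prop. 3.10] -/
theorem map_nsmul_whiskerRight_monomial (N : ℕ) (θ : bettiCohomology A.X 2) (j e n : ℕ) {m mm : ℕ}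
    (h₂ : 2 * e + 2 * n = 2 * m) (h₁ : 2 * j + 2 * m = 2 * mm) :
    complexBetti.map ((N • 𝟙 A).hom.hom.hom ▷ A.X) (2 * mm)
        (cupProduct h₁ (cupPow ℂ (complexBetti.map (fst A.X A.X) 2 Θℂ[A, θ]) j)
          (cupProduct h₂ (cupPow ℂ ℓℂ[A, θ] e) (cupPow ℂ (complexBetti.map (snd A.X A.X) 2 Θℂ[A, θ]) n))) =
      ((N : ℂ) ^ (2 * j + e)) •
        cupProduct h₁ (cupPow ℂ (complexBetti.map (fst A.X A.X) 2 Θℂ[A, θ]) j)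
          (cupProduct h₂ (cupPow ℂ ℓℂ[A, θ] e) (cupPow ℂ (complexBetti.map (snd A.X A.X) 2 Θℂ[A, θ]) n)) := by
  have hfst : complexBetti.map ((N • 𝟙 A).hom.hom.hom ▷ A.X) 2 (complexBetti.map (fst A.X A.X) 2 Θℂ[A, θ]) =
      ((N : ℂ) ^ 2) • complexBetti.map (fst A.X A.X) 2 Θℂ[A, θ] := by
    rw [← complexBetti.map_comp_apply', whiskerRight_fst, complexBetti.map_comp_apply', complexBetti_map_nsmul_id_apply, map_smul]
  have hsnd : complexBetti.map ((N • 𝟙 A).hom.hom.hom ▷ A.X) 2 (complexBetti.map (snd A.X A.X) 2 Θℂ[A, θ]) =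
      (1 : ℂ) • complexBetti.map (snd A.X A.X) 2 Θℂ[A, θ] := by
    rw [← complexBetti.map_comp_apply', whiskerRight_snd, one_smul]
  rw [complexBetti.map_cupProduct, complexBetti.map_cupProduct, cupPow_eq_pow_smul_of_map_eq_smul _ hfst j,
    cupPow_eq_pow_smul_of_map_eq_smul _ (map_nsmul_whiskerRight_poincareClass A N θ) e, cupPow_eq_pow_smul_of_map_eq_smul _ hsnd n,
    one_pow, one_smul]
  simp only [map_smul, LinearMap.smul_apply, smul_smul]
  congr 1
  ring

/-- **SELECTION RULE: the monomial `pr₁^*θʲ ∪ (ℓ^e ∪ pr₂^*θⁿ)` (`j + e + n = g`) ACTS AS ZERO ON `Hᵃ(A)` FOR `a ≠ 2j + e`** (its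
`([2] × 1)^*`-weight is `2^{2j+e}`, part XXXVII-g₁'s `corrAction_eq_zero_of_whiskerRight_weight`). [cite: Kleiman1968AlgebraicCycles, §1.4 and Thm. 2A9]
[cite: MumfordAV1970, §19] -/
theorem corrAction_monomial_eq_zero_of_ne {k : ℕ} (hA : IsSmoothProjective (k + 1) A.X) (θ : bettiCohomology A.X 2) (j e n : ℕ) {m : ℕ}
    (h₂ : 2 * e + 2 * n = 2 * m) (h₁ : 2 * j + 2 * m = 2 * (k + 1)) {a : ℕ} (ha : a ≠ 2 * j + e) (x : complexBetti A.X a) :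
    corrAction complexOrientationFamily hA hA (rfl : a + 2 * (k + 1) = a + 2 * (k + 1))
      (cupProduct h₁ (cupPow ℂ (complexBetti.map (fst A.X A.X) 2 Θℂ[A, θ]) j)
        (cupProduct h₂ (cupPow ℂ ℓℂ[A, θ] e) (cupPow ℂ (complexBetti.map (snd A.X A.X) 2 Θℂ[A, θ]) n))) x = 0 :=
  corrAction_eq_zero_of_whiskerRight_weight hA ((2 • 𝟙 A).hom.hom.hom) (N := 2) le_rfl (complexBetti_map_nsmul_id_apply A 2)
    (map_nsmul_whiskerRight_monomial A 2 θ j e n h₂ h₁) ha x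

/-- **THE MONOMIAL OF WEIGHT `i` ACTS AS THE KLEIMAN WORD**: for `2j ≤ i`, `e = i - 2j`, `n = s + j`, `i + s = g`,
`[pr₁^*θʲ ∪ (ℓ^e ∪ pr₂^*θⁿ)]_* x = θʲ ∪ [ℓ^e]_*((x ∪ θˢ) ∪ θʲ)` on `Hⁱ(A)` (the `pr₁^*`-factor comes out in front, the `pr₂^*`-factor goes
onto the argument, `θⁿ = θˢ ∪ θʲ`). [cite: VoisinHodgeII2003, proof of Thm. 10.17 (10.7)] [cite: Kleiman1968AlgebraicCycles, §1.3 and App. to §2] -/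
theorem corrAction_monomial_eq_word {k : ℕ} (hA : IsSmoothProjective (k + 1) A.X) (θ : bettiCohomology A.X 2) {i s j e n m : ℕ}
    (his : i + s = k + 1) (_hji : 2 * j ≤ i) (he : e = i - 2 * j) (hn : n = s + j)
    (h₂ : 2 * e + 2 * n = 2 * m) (h₁ : 2 * j + 2 * m = 2 * (k + 1)) (x : complexBetti A.X i) :
    corrAction complexOrientationFamily hA hA (rfl : i + 2 * (k + 1) = i + 2 * (k + 1))
      (cupProduct h₁ (cupPow ℂ (complexBetti.map (fst A.X A.X) 2 Θℂ[A, θ]) j)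
        (cupProduct h₂ (cupPow ℂ ℓℂ[A, θ] e) (cupPow ℂ (complexBetti.map (snd A.X A.X) 2 Θℂ[A, θ]) n))) x =
      cupProduct (show 2 * j + (i - 2 * j) = i by omega) (cupPow ℂ Θℂ[A, θ] j)
        (corrAction complexOrientationFamily hA hA (show i + 2 * s + 2 * j + 2 * (i - 2 * j) = (i - 2 * j) + 2 * (k + 1) by omega)
          (cupPow ℂ ℓℂ[A, θ] (i - 2 * j))
          (cupProduct (rfl : i + 2 * s + 2 * j = i + 2 * s + 2 * j)
            (cupProduct (rfl : i + 2 * s = i + 2 * s) x (cupPow ℂ Θℂ[A, θ] s)) (cupPow ℂ Θℂ[A, θ] j))) := by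
  subst he hn
  rw [← complexBetti_map_cupPow (fst A.X A.X), ← complexBetti_map_cupPow (snd A.X A.X),
    corrAction_cupProduct_map_fst complexOrientationFamily hA h₁ (show i + 2 * m = (i - 2 * j) + 2 * (k + 1) by omega)
      (rfl : i + 2 * (k + 1) = i + 2 * (k + 1)) (show 2 * j + (i - 2 * j) = i by omega) ⟨j, two_mul j⟩ _ _ x,
    corrAction_cupProduct_map_snd' complexOrientationFamily hA h₂ (show i + 2 * (s + j) = i + 2 * s + 2 * j by omega)
      (show i + 2 * s + 2 * j + 2 * (i - 2 * j) = (i - 2 * j) + 2 * (k + 1) by omega)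
      (show i + 2 * m = (i - 2 * j) + 2 * (k + 1) by omega),
    ← cupProduct_cupPow_cupPow Θℂ[A, θ] s j (s + j) (by omega),
    ← cupProduct_assoc (rfl : i + 2 * s = i + 2 * s) (show 2 * s + 2 * j = 2 * (s + j) by omega)
      (rfl : i + 2 * s + 2 * j = i + 2 * s + 2 * j) (show i + 2 * (s + j) = i + 2 * s + 2 * j by omega)]

/-- **The inner binomial expansion under `[·]_*`**: `[pr₁^*θʲ ∪ (ℓ + pr₂^*θ)^{m}]_* x = Σ_e C(m,e) · [pr₁^*θʲ ∪ (ℓ^e ∪ pr₂^*θ^{m-e})]_* x`.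
[cite: HatcherAT2002, §3.2 Thm. 3.11 and Example 3.12] -/
theorem corrAction_fst_cupPow_add_eq_sum {k : ℕ} (hA : IsSmoothProjective (k + 1) A.X) (θ : bettiCohomology A.X 2) (j m : ℕ)
    (h₁ : 2 * j + 2 * m = 2 * (k + 1)) {a : ℕ} (x : complexBetti A.X a) :
    corrAction complexOrientationFamily hA hA (rfl : a + 2 * (k + 1) = a + 2 * (k + 1))
      (cupProduct h₁ (cupPow ℂ (complexBetti.map (fst A.X A.X) 2 Θℂ[A, θ]) j)
        (cupPow ℂ (ℓℂ[A, θ] + complexBetti.map (snd A.X A.X) 2 Θℂ[A, θ]) m)) x =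
      ∑ e : Fin (m + 1), ((m.choose e : ℕ) : ℂ) •
        corrAction complexOrientationFamily hA hA (rfl : a + 2 * (k + 1) = a + 2 * (k + 1))
          (cupProduct h₁ (cupPow ℂ (complexBetti.map (fst A.X A.X) 2 Θℂ[A, θ]) j)
            (cupProduct (two_mul_val_add_two_mul_sub e) (cupPow ℂ ℓℂ[A, θ] e)
              (cupPow ℂ (complexBetti.map (snd A.X A.X) 2 Θℂ[A, θ]) (m - e)))) x := by
  rw [cupPow_add_eq_sum_choose, map_sum, map_sum, LinearMap.sum_apply]
  refine Finset.sum_congr rfl fun e _ ↦ ?_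
  rw [map_smul, map_smul, LinearMap.smul_apply]

end Monomials

/-! ## §3 Scholl's formula: `[m^*θ^g]_*` on `Hⁱ` is the Kleiman combination; the Kleiman identity of every block -/

section Scholl

variable (A : AbelianVariety ℂ)

/-- `Θ` — the complexification `θ ⊗ 1 ∈ H²(A(ℂ); ℂ)` of a rational degree-two class (display notation). -/
local notation3 (prettyPrint := false) "Θℂ[" A ", " θ "]" => ofRatClass (ComplexPoints (AbelianVariety.X A)) 2 θ
/-- `ℓ` — the complexified Poincaré (Mumford) class `(m^*θ − pr₁^*θ − pr₂^*θ) ⊗ 1 ∈ H²((A × A)(ℂ); ℂ)` (display notation). -/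
local notation3 (prettyPrint := false) "ℓℂ[" A ", " θ "]" => ofRatClass (ComplexPoints (AbelianVariety.X A ⊗ AbelianVariety.X A)) 2
  (BettiUniverse.pull μ[AbelianVariety.X A] 2 θ - BettiUniverse.pull (fst (AbelianVariety.X A) (AbelianVariety.X A)) 2 θ -
    BettiUniverse.pull (snd (AbelianVariety.X A) (AbelianVariety.X A)) 2 θ)

/-- Re-indexing a sum over `Fin m` whose terms vanish from `n` on by `Fin n` (`n ≤ m`). [folklore] -/
theorem sum_univ_eq_sum_castLE {V : Type*} [AddCommMonoid V] {n m : ℕ} (h : n ≤ m) (F : Fin m → V)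
    (hF : ∀ j : Fin m, n ≤ (j : ℕ) → F j = 0) : ∑ j, F j = ∑ l : Fin n, F (Fin.castLE h l) := by
  have hmap : ∑ l : Fin n, F (Fin.castLE h l) = ∑ j ∈ (Finset.univ : Finset (Fin n)).map (Fin.castLEEmb h), F j := by
    rw [Finset.sum_map]
    rfl
  rw [hmap]
  refine (Finset.sum_subset (Finset.subset_univ _) fun j _ hj ↦ hF j ?_).symm
  by_contra hlt
  exact hj (Finset.mem_map.2 ⟨⟨j, by omega⟩, Finset.mem_univ _, Fin.ext rfl⟩)

/-- **SCHOLL'S FORMULA, EXPANDED FORM: `[m^*θ^g]_*` ON `Hⁱ(A)` IS THE KLEIMAN COMBINATION.** For `g = k + 1`, `i + s = g` and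
`x ∈ Hⁱ(A(ℂ); ℂ)`: `[m^*θ^g]_* x = Σ_{l ≤ M} C(g,l) C(g-l,i-2l) · θˡ ∪ [ℓ^{i-2l}]_*((x ∪ θˢ) ∪ θˡ)`, `M = i/2` (trinomial expansion of
`(pr₁^*θ + ℓ + pr₂^*θ)^g`, the selection rule, and the word lemma). With part XXXIX-a (`[m^*θ^g]_* = (-1)^i c`) this is Scholl's
(5.9.1) / Milne's Rem. 5.11 in cohomology: `f_i ∘ L^{g-i} = const · id` for `f_i = Σ_j 1/(j!(g-i+j)!(i-2j)!) pr₁^*θʲ pr₂^*θʲ ℓ^{i-2j}`.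
[cite: Scholl1994ClassicalMotives, §5 (5.9.1)] [cite: Milne1999LefschetzClasses, Rem. 5.11] [cite: Kunnemann1993, Thm. 3.1] -/
theorem corrAction_pullMul_cupPow_eq_sum {k : ℕ} (hA : IsSmoothProjective (k + 1) A.X) (θ : bettiCohomology A.X 2) {i s M : ℕ}
    (hM : M = i / 2) (his : i + s = k + 1) (x : complexBetti A.X i) :
    corrAction complexOrientationFamily hA hA (rfl : i + 2 * (k + 1) = i + 2 * (k + 1))
        (complexBetti.map μ[A.X] (2 * (k + 1)) (cupPow ℂ Θℂ[A, θ] (k + 1))) x =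
      ∑ l : Fin (M + 1), (((k + 1).choose l : ℂ) * ((k + 1 - l).choose (i - 2 * l) : ℂ)) •
        cupProduct (show 2 * (l : ℕ) + (i - 2 * l) = i by have := l.2; omega) (cupPow ℂ Θℂ[A, θ] l)
          (corrAction complexOrientationFamily hA hA
            (show i + 2 * s + 2 * (l : ℕ) + 2 * (i - 2 * l) = (i - 2 * l) + 2 * (k + 1) by have := l.2; omega)
            (cupPow ℂ ℓℂ[A, θ] (i - 2 * l))
            (cupProduct (rfl : i + 2 * s + 2 * (l : ℕ) = i + 2 * s + 2 * l)
              (cupProduct (rfl : i + 2 * s = i + 2 * s) x (cupPow ℂ Θℂ[A, θ] s)) (cupPow ℂ Θℂ[A, θ] l))) := by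
  subst hM
  have hik : i / 2 + 1 ≤ k + 1 + 1 := by omega
  -- the `j`-th term of the outer binomial expansion, `2j ≤ i`: one inner term survives
  have hval : ∀ (j : Fin (k + 1 + 1)) (hj : 2 * (j : ℕ) ≤ i),
      corrAction complexOrientationFamily hA hA (rfl : i + 2 * (k + 1) = i + 2 * (k + 1))
        (cupProduct (two_mul_val_add_two_mul_sub j) (cupPow ℂ (complexBetti.map (fst A.X A.X) 2 Θℂ[A, θ]) j)
          (cupPow ℂ (ℓℂ[A, θ] + complexBetti.map (snd A.X A.X) 2 Θℂ[A, θ]) (k + 1 - j))) x =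
      ((k + 1 - j).choose (i - 2 * j) : ℂ) • cupProduct (show 2 * (j : ℕ) + (i - 2 * j) = i by omega) (cupPow ℂ Θℂ[A, θ] j)
          (corrAction complexOrientationFamily hA hA
            (show i + 2 * s + 2 * (j : ℕ) + 2 * (i - 2 * j) = (i - 2 * j) + 2 * (k + 1) by omega)
            (cupPow ℂ ℓℂ[A, θ] (i - 2 * j))
            (cupProduct (rfl : i + 2 * s + 2 * (j : ℕ) = i + 2 * s + 2 * j)
              (cupProduct (rfl : i + 2 * s = i + 2 * s) x (cupPow ℂ Θℂ[A, θ] s)) (cupPow ℂ Θℂ[A, θ] j))) := by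
    intro j hj
    rw [corrAction_fst_cupPow_add_eq_sum]
    have he₀ : i - 2 * (j : ℕ) < k + 1 - j + 1 := by omega
    rw [Finset.sum_eq_single (⟨i - 2 * j, he₀⟩ : Fin (k + 1 - j + 1))]
    · rw [corrAction_monomial_eq_word A hA θ his hj rfl (show k + 1 - (j : ℕ) - (i - 2 * j) = s + j by omega)]
    · intro e _ hne
      rw [corrAction_monomial_eq_zero_of_ne A hA θ _ _ _ _ _ (show i ≠ 2 * (j : ℕ) + e from fun h ↦ hne (Fin.ext (by
        change (e : ℕ) = i - 2 * j; omega))), smul_zero]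
    · exact fun h ↦ absurd (Finset.mem_univ _) h
  -- the `j`-th term, `2j > i`: every inner term dies
  have hzero : ∀ j : Fin (k + 1 + 1), i < 2 * (j : ℕ) →
      corrAction complexOrientationFamily hA hA (rfl : i + 2 * (k + 1) = i + 2 * (k + 1))
        (cupProduct (two_mul_val_add_two_mul_sub j) (cupPow ℂ (complexBetti.map (fst A.X A.X) 2 Θℂ[A, θ]) j)
          (cupPow ℂ (ℓℂ[A, θ] + complexBetti.map (snd A.X A.X) 2 Θℂ[A, θ]) (k + 1 - j))) x = 0 := by
    intro j hj
    rw [corrAction_fst_cupPow_add_eq_sum]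
    refine Finset.sum_eq_zero fun e _ ↦ ?_
    rw [corrAction_monomial_eq_zero_of_ne A hA θ _ _ _ _ _ (show i ≠ 2 * (j : ℕ) + e by omega), smul_zero]
  -- expand `m^*θ^g = (pr₁^*θ + (ℓ + pr₂^*θ))^g` and evaluate term by term
  rw [complexBetti_map_cupPow, map_mul_ofRatClass_two_eq, cupPow_add_eq_sum_choose, map_sum, LinearMap.sum_apply]
  refine (sum_univ_eq_sum_castLE hik _ fun j hj ↦ ?_).trans (Finset.sum_congr rfl fun l _ ↦ ?_)
  · rw [map_smul, LinearMap.smul_apply, hzero j (by omega), smul_zero]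
  · rw [map_smul, LinearMap.smul_apply, hval (Fin.castLE hik l) (by rw [Fin.val_castLE]; have := l.2; omega), smul_smul]
    rfl

/-- **THE KLEIMAN IDENTITY OF EVERY MIDDLE LEFSCHETZ BLOCK (Scholl's formula).** For a complex abelian variety `A` of dimension
`g = k + 1`, a rational class `θ` whose complexification is a polarisation, and a block `(b, r)` with `b + r + 1 = k`: with the exponent
pairs `(i_l, j_l) = (b + 1 - 2l, l)`, `0 ≤ l ≤ (b+1)/2`, and the coefficients `c_l = C(g,l) C(g-l, b+1-2l)` (Scholl's
`1/(l!(g-b-1+l)!(b+1-2l)!)` times `g!`) one has, for every `x ∈ H^{b+1}(A(ℂ); ℂ)`,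
**`Σ_l c_l · θ^{j_l} ∪ [ℓ^{i_l}]_*((x ∪ θ^{r+1}) ∪ θ^{j_l}) = c₀ · x`, `c₀ ≠ 0`** (`c₀ = (-1)^{b+1} c`, `c` the constant of part XXXIX-a,
non-zero by the block `b = 0` of part XXXVII-f) — EXACTLY the hypothesis `hF` of part XXXVIII-j, for every `b`.
[cite: Scholl1994ClassicalMotives, §5 (5.9.1)] [cite: Milne1999LefschetzClasses, Rem. 5.11] [cite: Kleiman1968AlgebraicCycles, App. to §2, 2A9–2A11]
[cite: Kunnemann1993, Thm. 3.1] -/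
theorem exists_kleimanCoefficients_block {b r k : ℕ} (hbr : b + r + 1 = k) (hA : IsSmoothProjective (k + 1) A.X)
    (hdim : A.dim = k + 1) (θ : bettiCohomology A.X 2) (hθpol : IsPolarizationClass (k + 1) A.X Θℂ[A, θ]) :
    ∃ (n' : ℕ) (i j : Fin n' → ℕ) (hij : ∀ l, i l + 2 * j l = b + 1) (c : Fin n' → ℂ) (c₀ : ℂ), c₀ ≠ 0 ∧
      ∀ x' : complexBetti A.X (b + 1),
        ∑ l, c l • cupProduct (show 2 * j l + i l = b + 1 by have := hij l; omega) (cupPow ℂ Θℂ[A, θ] (j l))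
          (corrAction complexOrientationFamily hA hA (show b + 1 + 2 * (r + 1) + 2 * j l + 2 * i l = i l + 2 * (k + 1) by
              have := hij l; omega)
            (cupPow ℂ ℓℂ[A, θ] (i l))
            (cupProduct (rfl : b + 1 + 2 * (r + 1) + 2 * j l = b + 1 + 2 * (r + 1) + 2 * j l)
              (cupProduct (rfl : b + 1 + 2 * (r + 1) = b + 1 + 2 * (r + 1)) x'
                (cupPow ℂ Θℂ[A, θ] (r + 1)))
              (cupPow ℂ Θℂ[A, θ] (j l)))) = c₀ • x' := by
  obtain ⟨c, hc⟩ := exists_corrAction_pullMul_top_eq_smul A hA (cupPow ℂ Θℂ[A, θ] (k + 1))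
  -- `c ≠ 0`: on `H¹` the expansion reads `(k+1) · [ℓ]_*(x ∪ θᵏ) = (k+1) c₁ · x`, `c₁ ≠ 0` (part XXXVII-f), while `[m^*θ^g]_* = -c` there
  have hc0 : c ≠ 0 := by
    obtain ⟨θ', ℓ', c₁, hθ', hℓ', -, hc₁, hinv⟩ := exists_polarClass_inverts_lefschetz A (k := k) hdim.symm hA hθpol
    obtain rfl : θ = θ' := ofRatClass_injective _ hθ'.symm
    subst hℓ'
    obtain ⟨x, hx⟩ : ∃ x : complexBetti A.X 1, x ≠ 0 := by
      haveI := (abelianVarietyCohomologyExteriorH1_holds A).1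
      exact (Module.finrank_pos_iff_exists_ne_zero (R := ℂ)).1
        (by rw [(abelianVarietyCohomologyExteriorH1_holds A).2.1, hdim]; omega)
    have h1 : ((-1 : ℂ) ^ 1 * c) • x = ((((k + 1).choose 0 : ℕ) : ℂ) * (((k + 1 - 0).choose (1 - 2 * 0) : ℕ) : ℂ)) •
        cupProduct (show 2 * 0 + 1 = 1 by norm_num) (cupPow ℂ Θℂ[A, θ] 0)
          (corrAction complexOrientationFamily hA hA (show 1 + 2 * k + 2 * 0 + 2 * 1 = 1 + 2 * (k + 1) by omega)
            (cupPow ℂ ℓℂ[A, θ] 1)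
            (cupProduct (rfl : 1 + 2 * k + 2 * 0 = 1 + 2 * k + 2 * 0)
              (cupProduct (rfl : 1 + 2 * k = 1 + 2 * k) x (cupPow ℂ Θℂ[A, θ] k)) (cupPow ℂ Θℂ[A, θ] 0))) := by
      rw [← hc 1 x, corrAction_pullMul_cupPow_eq_sum A hA θ (M := 0) (by norm_num) (show 1 + k = k + 1 by omega) x,
        Fin.sum_univ_one]
      rfl
    rw [cupPow_zero, cupPow_one_eq,
      corrAction_cupProduct_one complexOrientationFamily hA (show 1 + 2 * k + 0 = 1 + 2 * k + 2 * 0 from rfl) _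
        (show 1 + 2 * k + 2 * 1 = 1 + 2 * (k + 1) by omega),
      hinv x, show ∀ V : complexBetti A.X 1, cupProduct (show 2 * 0 + 1 = 1 by norm_num) (singularCohomology.one ℂ (ComplexPoints A.X)) V = V
        from fun V ↦ one_cupProduct V, smul_smul] at h1
    intro hc'
    rw [hc', mul_zero, zero_smul, eq_comm, smul_eq_zero] at h1
    refine hc₁ ?_
    rcases h1 with h1 | h1
    · simp only [Nat.choose_zero_right, Nat.sub_zero, Nat.mul_zero, Nat.choose_one_right, Nat.cast_one, one_mul, mul_eq_zero,
        Nat.cast_eq_zero, Nat.succ_ne_zero, false_or] at h1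
      exact h1
    · exact absurd h1 hx
  refine ⟨(b + 1) / 2 + 1, fun l ↦ b + 1 - 2 * l, fun l ↦ l, fun l ↦ by beta_reduce; have := l.2; omega,
    fun l ↦ ((k + 1).choose l : ℂ) * ((k + 1 - l).choose (b + 1 - 2 * l) : ℂ), (-1) ^ (b + 1) * c,
    mul_ne_zero (pow_ne_zero _ (neg_ne_zero.2 one_ne_zero)) hc0, fun x' ↦ ?_⟩
  rw [← hc (b + 1) x']
  exact (corrAction_pullMul_cupPow_eq_sum A hA θ (M := (b + 1) / 2) rfl (show b + 1 + (r + 1) = k + 1 by omega) x').symm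

end Scholl

end Summit.HodgeConjecture.HodgeConjecture.Ring2.AbelianAll

end
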